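import Summits.Ventures.HodgeRepro2.T7SupportBergmanOneVectorWeightOne

/-!
# The vanishing locus of `hq` for `u_A = z` in terms of the invariant `κ(1)` (support, seat p1)

Row 705 (`T7SupportBergmanOneVectorWeightOne`): for `h ∉ K`, `hq` at the `K`-type `m + 1` for `u_A = z` in the weight-`k`
model holds iff `|b(h)|² k ≠ m + 1`. The double-coset invariant of `γ₀ = 1` is `κ(1) = |a(h)|² = 1 + |b(h)|²`
(`T7SupportKappaCartan.kappa_eq_normSq`), so the condition reads, in the line's own invariant,

  **`hq ⟺ κ(1) · k ≠ m + 1 + k`**   (`hq_weightOne_succ_iff_kappa`)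

— for `π⁰_triv` (`k = 3`, `m + 1 = 1`): `κ(1) ≠ 4/3`. The dictionary identifies `κ(1)` at `ι_j` with the two-torus
invariant of the real datum (x1 l. 14948 (i), L1-p5's `KappaPlaces`), so the condition is a statement about the hermitian
data of `X` in words.

Explicit model only; nothing about the adelic group or any period.
Blind lane: Mathlib + the HodgeRepro2 prefix only; no sorry; axioms ⊆ {propext, Classical.choice, Quot.sound}.
-/

namespace Summit.Ventures.HodgeRepro2.T7SupportBergmanOneVectorWeightOneKappa

open T5SU11Unimodular T5SU11Fibration T5BergmanCoefficient T7SupportTwoTorusInvariant T7SupportKappaCartan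
  T7SupportBergmanOneVectorMonomial T7SupportBergmanOneVectorWeightOne

/-- `κ(1) = 1 + |b(h)|²` -/
theorem kappa_one_eq (h : SU11) :
    (kappa (starRingEnd ℂ) dd (colBasis h) (mat 1)).re = 1 + Complex.normSq (mat h 0 1) := by
  rw [kappa_eq_normSq, Complex.ofReal_re, one_mul, normSq_zero_zero_eq]

variable [MeasurableSpace Circle] [BorelSpace Circle]

/-- **`hq` for `u_A = z` at the `K`-type `m + 1`, in the invariant**: for `h ∉ K`, `Φ(1) ≠ 0 ⟺ κ(1) · k ≠ m + 1 + k` -/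
theorem hq_weightOne_succ_iff_kappa (k : ℕ) (hk : 2 ≤ k) (h : SU11) (hB : mat h 0 1 ≠ 0) (m : ℕ) :
    monomialFourierCoeff k 1 h (-((k + 2 * (m + 1) : ℕ) : ℤ)) 1 ≠ 0 ↔
      (kappa (starRingEnd ℂ) dd (colBasis h) (mat 1)).re * k ≠ m + 1 + k := by
  rw [hq_weightOne_succ_iff k hk h hB m, kappa_one_eq]
  constructor
  · intro h1 h2
    apply h1
    linarith
  · intro h1 h2
    apply h1
    linarith

/-- **the line's case `π⁰_triv`** (`k = 3`, `u_B` of the `K`-type `1`): `hq ⟺ κ(1) ≠ 4/3` -/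
theorem hq_weightOne_three_iff_kappa (h : SU11) (hB : mat h 0 1 ≠ 0) :
    monomialFourierCoeff 3 1 h (-((3 + 2 * (0 + 1) : ℕ) : ℤ)) 1 ≠ 0 ↔
      (kappa (starRingEnd ℂ) dd (colBasis h) (mat 1)).re ≠ 4 / 3 := by
  rw [hq_weightOne_succ_iff_kappa 3 (by norm_num) h hB 0]
  push_cast
  constructor
  · intro h1 h2
    apply h1
    rw [h2]
    norm_num
  · intro h1 h2
    apply h1
    linarith

end Summit.Ventures.HodgeRepro2.T7SupportBergmanOneVectorWeightOneKappa
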